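import Summits.CriticalPhenomena.PercolationContinuityZ3.Theorems.PercNearOneGluingNoHeavyLowerTailSunflowerSpectatorTransfer
import Summits.CriticalPhenomena.PercolationContinuityZ3.Theorems.PercNearOneGluingNoHeavyLowerTailSunflowerHallGladkovProof
import HarnessLib

/-!
# `NoHeavyLowerTail` (crux stmt-CriticalPhenomena-4575), abstract sunflower cubic: the spectator-transfer inequality and the quantitative ★
# `ZH ≥ 3·Sw 1_{1}` behind an INTERSECTING petal (unconditional)

Support file (seat `prim-ineq-gen-2` gen 22; `--supports stmt-CriticalPhenomena-4575`).  No `sorry`, no new definitions.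
Memo: run/shared/lean/prim/prim-ineq-gen-2/SPECTATOR-TRANSFER-GEN22.md §2.

`…SunflowerSpectatorTransfer` typed the census-true conjecture `SpectatorTransfer` (`2·Nabk k ≤ SA + SB + 2·Nkk k` for every petal `k`) and proved it behind a
centred petal.  Here: behind an INTERSECTING petal `1` (no two disjoint label-`1` sets) it is a THEOREM — prim-l12-p2's `two_N140_le_SB_of_ixGen` with
`ixGen_holds` (`…SunflowerHallGladkovProof`) gives `2·Nabk 1 = 2·N140 ≤ SB` — and, since then `Nkk 1 = 0`, the petal-spectator identity `three_Sw_petal_eq` turns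
it into the QUANTITATIVE partition lemma `0 ≤ 3·Sw 1_{1} ≤ ZH`: the ★-slack of a sunflower with an intersecting petal is at least the (nonnegative) antipodal-Gladkov
surplus seen by the spectators of that petal (l12-p2's `ZH_nonneg_of_intersecting` gives `0 ≤ ZH`).
-/

namespace Summit.CriticalPhenomena.PercolationContinuityZ3.Theorems.SunflowerPartition

open Finset

namespace Sunflower

variable {α : Type} [Fintype α] [DecidableEq α] (F : Sunflower α)

/-- Behind an intersecting petal `1` there is no ordered 3-partition with two label-`1` blocks: `Nkk 1 = 0`. [this work] -/
theorem Nkk_one_eq_zero_of_intersecting (hI : ∀ S T : Finset α, F.lab S = 1 → F.lab T = 1 → ¬ Disjoint S T) : F.Nkk 1 = 0 := by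
  unfold Nkk
  refine sum_eq_zero fun q hq => ?_
  unfold parts at hq
  rw [mem_filter] at hq
  split_ifs with h
  · exact ((hI q.1 q.2 h.1 h.2) hq.2).elim
  · rfl

/-- **The spectator-transfer inequality behind an INTERSECTING petal `1`** (unconditional): `2·Nabk 1 ≤ SA + SB + 2·Nkk 1`. [this work] -/
theorem spectatorTransfer_one_of_intersecting (hI : ∀ S T : Finset α, F.lab S = 1 → F.lab T = 1 → ¬ Disjoint S T) :
    2 * F.Nabk 1 ≤ F.SA + F.SB + 2 * F.Nkk 1 := by
  have h1 := F.two_N140_le_SB_of_ixGen ixGen_holds hI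
  have h2 := F.SA_nonneg
  have h3 := F.Nkk_nonneg 1
  rw [F.Nabk_one_eq_N140]
  linarith

/-- **QUANTITATIVE ★ BEHIND AN INTERSECTING PETAL `1`** (unconditional): `0 ≤ 3·Sw 1_{1} ≤ ZH` — the ★-slack is at least the antipodal-Gladkov surplus behind
the petal-`1` spectators. [this work] -/
theorem three_Sw_one_le_ZH_of_intersecting (hI : ∀ S T : Finset α, F.lab S = 1 → F.lab T = 1 → ¬ Disjoint S T) :
    0 ≤ 3 * F.Sw (fun v => if v = 1 then 1 else 0) ∧ 3 * F.Sw (fun v => if v = 1 then 1 else 0) ≤ F.ZH := by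
  have hS : 0 ≤ F.Sw (fun v => if v = 1 then 1 else 0) := F.Sw_nonneg _ fun v => by split_ifs <;> norm_num
  have h1 := F.spectatorTransfer_one_of_intersecting hI
  have h2 := F.three_Sw_petal_eq 1 (by decide) (by decide)
  have h3 := F.Nkk_one_eq_zero_of_intersecting hI
  have h4 := F.NkkForeign_nonneg 1
  have h5 := F.NkkForeign_le_Nkk 1
  rw [F.ZH_eq_SA_SB]
  refine ⟨by linarith, ?_⟩
  rw [h3] at h1 h5
  linarith

end Sunflower

end Summit.CriticalPhenomena.PercolationContinuityZ3.Theorems.SunflowerPartition
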